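import Literature.NumberTheory.LFunctions.MauduitRivatWindowCountSharp
import HarnessLib

/-!
# The smoothing error of Mauduit–Rivat's type-II sums, counted by exponential sums (proved)

Everything in this file is PROVED. The error made in §6.2 of C. Mauduit, J. Rivat, *Prime
numbers along Rudin–Shapiro sequences*, J. Eur. Math. Soc. 17 (2015), (64)–(70), when the sharp
cut-off of the middle digits is replaced by a smooth one, is controlled by
`∑_{(m,n)} min(1, X/T(mn+c))`, `T(x)` the distance of `x mod k^{μ₀}` to the carry boundary
(`gridDist`). The tree's `sum_box_min_le` counts the pairs with `T(mn+c) ≤ W` by windows, which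
is only useful when the `n`-range is longer than the window. Here the same pairs are counted by
the exponential-sum method of Lemma 9 (`card_box_block_mem_le_sharp`): `T(x) ≤ k^w` forces the
block `⌊(x mod k^{μ₀})/k^w⌋` to be the first or the last one, so that

* `block_mem_of_gridDist_le` — `T_{K'L'}(x) ≤ L'` implies `⌊(x mod K'L')/L'⌋ ∈ {0, K'−1}`;
* `card_box_gridDist_le_sharp` — the pairs `(m,n) ∈ [M₀,M₁) × [N₀,N₀+N)` with
  `T(mn+c) ≤ k^w` (`w ≤ μ₀`, `M₀ ≥ 1`) number at most
  `4 (k^w/k^{μ₀}) M' N + 8 (M₁/k^{μ₀}+1)(1+log k^{μ₀})(2Nτ(k^{μ₀}) + 2k^w + k^{μ₀}(1+log k^{μ₀})) + 2M'(N/k^w+3) + 8τ(k^w)M₁N/k^w`;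
* **`sum_box_min_le_sharp`** — `∑_{(m,n)} min(1, X/T(mn+c)) ≤ (that count) + (X/k^w) M' N`,
  valid whatever the relative size of `N` and the window (this is what the blocks with a long
  Cauchy–Schwarz variable need).

## References
* C. Mauduit, J. Rivat, J. Eur. Math. Soc. 17 (2015), §6.2, (64)–(70), and Lemma 9. [MauduitRivat2015]
* C. Müllner, Duke Math. J. 166 (2017) = arXiv:1602.03042, §5.4.2. [Mullner2017]
-/

noncomputable section

open Finset

namespace Literature.NumberTheory.LFunctions.MauduitRivat

/-- `T(x) ≤ L'` (distance to the carry boundary modulo `K = K'L'`, `K' ≥ 1`) forces the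
`L'`-block of `x mod K` to be the first or the last one. [folklore] -/
theorem block_mem_of_gridDist_le {K K' L' : ℕ} (hK : K = K' * L') (hK' : 0 < K') (hL' : 0 < L')
    {x : ℕ} (hKL : gridDist K x ≤ L') :
    x % K / L' ∈ ({0, K' - 1} : Finset ℕ) := by
  rw [mem_insert, mem_singleton]
  rw [gridDist_apply] at hKL
  have hKpos : 0 < K := by rw [hK]; exact Nat.mul_pos hK' hL'
  have hxK : x % K < K := Nat.mod_lt _ hKpos
  rcases le_total (x % K) (K - 1 - x % K) with hle | hle
  · rw [min_eq_left hle] at hKL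
    left
    exact Nat.div_eq_of_lt (by omega)
  · rw [min_eq_right hle] at hKL
    right
    have h1 : (K' - 1) * L' ≤ x % K := by
      have : (K' - 1) * L' = K - L' := by rw [hK, Nat.sub_mul, one_mul]
      omega
    have h2 : x % K / L' < K' := by
      rw [Nat.div_lt_iff_lt_mul hL']
      have : K = K' * L' := hK
      calc x % K < K := hxK
        _ = K' * L' := this
    have h3 : K' - 1 ≤ x % K / L' := (Nat.le_div_iff_mul_le hL').2 h1
    omega

/-- **The pairs near the carry boundary, counted by exponential sums**: for `k ≥ 1`, `w ≤ μ₀`,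
`M₀ ≥ 1`, the pairs `(m,n) ∈ [M₀,M₁) × [N₀,N₀+N)` with `T(mn+c) ≤ k^w` (`T` = `gridDist k^{μ₀}`)
number at most
`2 (k^w/k^{μ₀}) 2 M' N + 4·2 (M₁/k^{μ₀}+1)(1+log k^{μ₀})(2Nτ(k^{μ₀}) + 2k^w + k^{μ₀}(1+log k^{μ₀})) + 2M'(N/k^w+3) + 8τ(k^w)M₁N/k^w`.
[cite: MauduitRivat2015, Lemma 9 (method) applied to (69)–(70)] -/
theorem card_box_gridDist_le_sharp {k : ℕ} (hk : 0 < k) {μ₀ w : ℕ} (hw : w ≤ μ₀) (c : ℕ)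
    {M₀ M₁ : ℕ} (hM₀ : 1 ≤ M₀) (N₀ N : ℕ) :
    ((((Ico M₀ M₁) ×ˢ (Ico N₀ (N₀ + N))).filter
        (fun p : ℕ × ℕ => gridDist (k ^ μ₀) (p.1 * p.2 + c) ≤ k ^ w)).card : ℝ) ≤
      2 * (((k ^ w : ℕ) : ℝ) / (k ^ μ₀ : ℕ) * 2 * ((M₁ - M₀ : ℕ) : ℝ) * N) +
        4 * 2 * ((M₁ / k ^ μ₀ + 1 : ℕ) : ℝ) * (1 + Real.log ((k ^ μ₀ : ℕ) : ℝ)) *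
          (2 * N * ((k ^ μ₀).divisors.card : ℝ) + 2 * (k ^ w : ℕ) +
            (k ^ μ₀ : ℕ) * (1 + Real.log ((k ^ μ₀ : ℕ) : ℝ))) +
        (2 * ((M₁ - M₀ : ℕ) : ℝ) * ((N : ℝ) / (k ^ w : ℕ) + 3) +
          8 * ((k ^ w).divisors.card : ℝ) * M₁ * N / (k ^ w : ℕ)) := by
  have hK : k ^ μ₀ = k ^ (μ₀ - w) * k ^ w := by rw [← pow_add, Nat.sub_add_cancel hw]
  have hK' : 0 < k ^ (μ₀ - w) := pow_pos hk _
  have hL' : 0 < k ^ w := pow_pos hk _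
  set B : Finset ℕ := {0, k ^ (μ₀ - w) - 1} with hBdef
  have hB : ∀ u ∈ B, u < k ^ (μ₀ - w) := by
    intro u hu
    rw [hBdef, mem_insert, mem_singleton] at hu
    rcases hu with rfl | rfl <;> omega
  have hBcard : (B.card : ℝ) ≤ 2 := by exact_mod_cast card_le_two
  -- inclusion of the filters
  have hsub : ((Ico M₀ M₁) ×ˢ (Ico N₀ (N₀ + N))).filter
        (fun p : ℕ × ℕ => gridDist (k ^ μ₀) (p.1 * p.2 + c) ≤ k ^ w) ⊆
      ((Ico M₀ M₁) ×ˢ (Ico N₀ (N₀ + N))).filter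
        (fun p : ℕ × ℕ => (p.1 * p.2 + c) % k ^ μ₀ / k ^ w ∈ B) := by
    intro p hp
    rw [mem_filter] at hp ⊢
    exact ⟨hp.1, block_mem_of_gridDist_le hK hK' hL' hp.2⟩
  have h1 : ((((Ico M₀ M₁) ×ˢ (Ico N₀ (N₀ + N))).filter
      (fun p : ℕ × ℕ => gridDist (k ^ μ₀) (p.1 * p.2 + c) ≤ k ^ w)).card : ℝ) ≤
      (((Ico M₀ M₁) ×ˢ (Ico N₀ (N₀ + N))).filter
        (fun p : ℕ × ℕ => (p.1 * p.2 + c) % k ^ μ₀ / k ^ w ∈ B)).card := by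
    exact_mod_cast card_le_card hsub
  have h2 := card_box_block_mem_le_sharp hK hL' (pow_pos hk _) hB c hM₀ N₀ N (M₁ := M₁)
  refine h1.trans (h2.trans ?_)
  have hlog : (0 : ℝ) ≤ Real.log ((k ^ μ₀ : ℕ) : ℝ) := Real.log_natCast_nonneg _
  gcongr

/-- **The smoothing error over a box, sharp form**: for `k ≥ 1`, `w ≤ μ₀`, `M₀ ≥ 1`, `X ≥ 0`,
`∑_{(m,n)∈[M₀,M₁)×[N₀,N₀+N)} min(1, X/T(mn+c)) ≤ #{(m,n) : T(mn+c) ≤ k^w} + (X/k^w) M' N`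
with the count bounded by `card_box_gridDist_le_sharp`. [cite: MauduitRivat2015, (64)–(70)] -/
theorem sum_box_min_le_sharp {k : ℕ} (hk : 0 < k) {μ₀ w : ℕ} (hw : w ≤ μ₀) {X : ℝ} (hX : 0 ≤ X)
    (c : ℕ) {M₀ M₁ : ℕ} (hM₀ : 1 ≤ M₀) (N₀ N : ℕ) :
    ∑ p ∈ (Ico M₀ M₁) ×ˢ (Ico N₀ (N₀ + N)), min 1 (X / (gridDist (k ^ μ₀) (p.1 * p.2 + c) : ℝ)) ≤
      (2 * (((k ^ w : ℕ) : ℝ) / (k ^ μ₀ : ℕ) * 2 * ((M₁ - M₀ : ℕ) : ℝ) * N) +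
        4 * 2 * ((M₁ / k ^ μ₀ + 1 : ℕ) : ℝ) * (1 + Real.log ((k ^ μ₀ : ℕ) : ℝ)) *
          (2 * N * ((k ^ μ₀).divisors.card : ℝ) + 2 * (k ^ w : ℕ) +
            (k ^ μ₀ : ℕ) * (1 + Real.log ((k ^ μ₀ : ℕ) : ℝ))) +
        (2 * ((M₁ - M₀ : ℕ) : ℝ) * ((N : ℝ) / (k ^ w : ℕ) + 3) +
          8 * ((k ^ w).divisors.card : ℝ) * M₁ * N / (k ^ w : ℕ))) +
      X / (k ^ w : ℕ) * (((M₁ - M₀ : ℕ) : ℝ) * N) := by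
  have hWR : (0 : ℝ) < (k ^ w : ℕ) := by exact_mod_cast pow_pos hk w
  set box := (Ico M₀ M₁) ×ˢ (Ico N₀ (N₀ + N)) with hbox
  set P : ℕ × ℕ → Prop := fun p => gridDist (k ^ μ₀) (p.1 * p.2 + c) ≤ k ^ w with hP
  rw [← sum_filter_add_sum_filter_not box P]
  refine add_le_add ?_ ?_
  · -- near the boundary: each term is at most `1`
    calc ∑ p ∈ box.filter P, min 1 (X / (gridDist (k ^ μ₀) (p.1 * p.2 + c) : ℝ))
        ≤ ∑ _p ∈ box.filter P, (1 : ℝ) := sum_le_sum fun p _ => min_le_left _ _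
      _ = ((box.filter P).card : ℝ) := by rw [sum_const, nsmul_eq_mul, mul_one]
      _ ≤ _ := card_box_gridDist_le_sharp hk hw c hM₀ N₀ N
  · -- away from the boundary: each term is at most `X / k^w`
    calc ∑ p ∈ box.filter (fun p => ¬ P p), min 1 (X / (gridDist (k ^ μ₀) (p.1 * p.2 + c) : ℝ))
        ≤ ∑ _p ∈ box.filter (fun p => ¬ P p), X / (k ^ w : ℕ) := by
          refine sum_le_sum fun p hp => (min_le_right _ _).trans ?_
          rw [mem_filter] at hp
          have hT : ((k ^ w : ℕ) : ℝ) ≤ gridDist (k ^ μ₀) (p.1 * p.2 + c) := by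
            have : k ^ w < gridDist (k ^ μ₀) (p.1 * p.2 + c) := lt_of_not_ge hp.2
            exact_mod_cast this.le
          exact div_le_div_of_nonneg_left hX hWR hT
      _ = ((box.filter (fun p => ¬ P p)).card : ℝ) * (X / (k ^ w : ℕ)) := by
          rw [sum_const, nsmul_eq_mul]
      _ ≤ (box.card : ℝ) * (X / (k ^ w : ℕ)) := by
          have hc : ((box.filter (fun p => ¬ P p)).card : ℝ) ≤ box.card := by
            exact_mod_cast card_le_card (filter_subset _ _)
          exact mul_le_mul_of_nonneg_right hc (by positivity)
      _ = X / (k ^ w : ℕ) * (((M₁ - M₀ : ℕ) : ℝ) * N) := by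
          rw [hbox, card_product, Nat.card_Ico, Nat.card_Ico, Nat.add_sub_cancel_left]
          push_cast; ring

end Literature.NumberTheory.LFunctions.MauduitRivat
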